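import Mathlib

/-!
# Finite bond percolation — measure-side definitions (blind cell PercRepro2, typer-1)

Bernoulli bond percolation on a finite edge type `E` with independent edge weights
`p : E → R` (edge `e` open with probability `p e`).  Everything is a *finite sum*:

* `Config E = E → Bool` — a configuration (`true` = open);
* `weight p ω = ∏ e, (p e if ω e else 1 - p e)` — the product Bernoulli weight;
* `expect p f = ∑ ω, weight p ω * f ω`, `prob p A = ∑ ω ∈ A, weight p ω`.

The API is organised around the *pinning* (= exploration) identity
`weight p ω = p e * weight (update p e 1) ω + (1 - p e) * weight (update p e 0) ω`:
conditioning on the state of an edge is the same as re-weighting with that edge pinned,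
on the *same* configuration space.  This is the finite-sum form of the spatial Markov
property used by the exploration-process lens of this cell.

Weights live in an arbitrary commutative ring `R` (`ℚ` for exact data, `ℝ` for analysis);
the order lemmas assume `[PartialOrder R] [IsOrderedRing R]`.
-/

namespace Summit.Ventures.PercRepro2

/-- A bond configuration on the edge type `E`: `ω e = true` means edge `e` is open. -/
abbrev Config (E : Type*) := E → Bool

section Weight

variable {E : Type*} [Fintype E] [DecidableEq E] {R : Type*} [CommRing R]

/-- Bernoulli factor of one edge with weight `q`: `q` if the edge is open, `1 - q` if closed. -/
def edgeFactor (q : R) (b : Bool) : R := if b then q else 1 - q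

/-- `edgeFactor` of an open edge. -/
@[simp] lemma edgeFactor_true (q : R) : edgeFactor q true = q := rfl

/-- `edgeFactor` of a closed edge. -/
@[simp] lemma edgeFactor_false (q : R) : edgeFactor q false = 1 - q := rfl

/-- The two Bernoulli factors of an edge sum to `1`. -/
lemma edgeFactor_true_add_false (q : R) : edgeFactor q true + edgeFactor q false = 1 := by
  simp

/-- Product Bernoulli weight of a configuration: `∏ e, (p e if ω e open else 1 - p e)`. -/
def weight (p : E → R) (ω : Config E) : R := ∏ e, edgeFactor (p e) (ω e)

/-- Expectation of `f : Config E → R` under the product Bernoulli weights `p`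
(a finite sum). -/
def expect (p : E → R) (f : Config E → R) : R := ∑ ω, weight p ω * f ω

/-- Probability of an event `A ⊆ Config E` under the product Bernoulli weights `p`:
the finite sum of the weights of the configurations in `A`. -/
noncomputable def prob (p : E → R) (A : Set (Config E)) : R := ∑ ω, A.indicator (weight p) ω

omit [DecidableEq E] in
/-- Unfolding lemma for `weight`. -/
lemma weight_apply (p : E → R) (ω : Config E) : weight p ω = ∏ e, edgeFactor (p e) (ω e) :=
  rfl

/-- Total mass one: the weights of all configurations sum to `1`. -/
lemma sum_weight (p : E → R) : ∑ ω : Config E, weight p ω = 1 := by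
  unfold weight
  rw [← Fintype.prod_sum (fun e b => edgeFactor (p e) b)]
  simp

/-- `prob` is the expectation of the indicator function. -/
lemma prob_eq_expect_indicator (p : E → R) (A : Set (Config E)) :
    prob p A = expect p (A.indicator 1) := by
  unfold prob expect
  refine Finset.sum_congr rfl fun ω _ => ?_
  by_cases h : ω ∈ A <;> simp [h]

/-- `prob` as a sum over the configurations of the event. -/
lemma prob_eq_sum_filter (p : E → R) (A : Set (Config E)) [DecidablePred (· ∈ A)] :
    prob p A = ∑ ω ∈ Finset.univ.filter (· ∈ A), weight p ω := by
  unfold prob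
  rw [Finset.sum_filter]
  refine Finset.sum_congr rfl fun ω _ => ?_
  by_cases h : ω ∈ A <;> simp [h]

/-- The expectation of the constant `1` is `1`. -/
@[simp] lemma expect_one (p : E → R) : expect p 1 = 1 := by
  simp [expect, sum_weight]

/-- The expectation of a constant. -/
@[simp] lemma expect_const (p : E → R) (c : R) : expect p (fun _ => c) = c := by
  simp [expect, ← Finset.sum_mul, sum_weight]

/-- Linearity: expectation of a sum. -/
lemma expect_add (p : E → R) (f g : Config E → R) :
    expect p (f + g) = expect p f + expect p g := by
  simp [expect, mul_add, Finset.sum_add_distrib]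

/-- Linearity: expectation of a scalar multiple. -/
lemma expect_const_mul (p : E → R) (c : R) (f : Config E → R) :
    expect p (fun ω => c * f ω) = c * expect p f := by
  simp [expect, Finset.mul_sum, mul_left_comm]

/-- Linearity: expectation of a difference. -/
lemma expect_sub (p : E → R) (f g : Config E → R) :
    expect p (f - g) = expect p f - expect p g := by
  simp [expect, mul_sub, Finset.sum_sub_distrib]

/-- The probability of the sure event is `1`. -/
@[simp] lemma prob_univ (p : E → R) : prob p Set.univ = 1 := by
  simp [prob, sum_weight]

/-- The probability of the empty event is `0`. -/
@[simp] lemma prob_empty (p : E → R) : prob p (∅ : Set (Config E)) = 0 := by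
  simp [prob]

/-- Inclusion–exclusion for two events. -/
lemma prob_union_add_prob_inter (p : E → R) (A B : Set (Config E)) :
    prob p (A ∪ B) + prob p (A ∩ B) = prob p A + prob p B := by
  unfold prob
  rw [← Finset.sum_add_distrib, ← Finset.sum_add_distrib]
  exact Finset.sum_congr rfl fun ω _ => Set.indicator_union_add_inter_apply _ _ _ _

/-- Complement rule. -/
lemma prob_compl (p : E → R) (A : Set (Config E)) : prob p Aᶜ = 1 - prob p A := by
  have h := prob_union_add_prob_inter p A Aᶜ
  simp only [Set.union_compl_self, prob_univ, Set.inter_compl_self, prob_empty, add_zero] at h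
  linear_combination -h

/-- Additivity on disjoint events. -/
lemma prob_union_of_disjoint (p : E → R) {A B : Set (Config E)} (h : Disjoint A B) :
    prob p (A ∪ B) = prob p A + prob p B := by
  have := prob_union_add_prob_inter p A B
  rwa [Set.disjoint_iff_inter_eq_empty.1 h, prob_empty, add_zero] at this

/-- Law of total probability over a partition into an event and its complement. -/
lemma prob_inter_add_prob_inter_compl (p : E → R) (A B : Set (Config E)) :
    prob p (A ∩ B) + prob p (A ∩ Bᶜ) = prob p A := by
  rw [← prob_union_of_disjoint p (Set.disjoint_of_subset_left Set.inter_subset_right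
    (Set.disjoint_of_subset_right Set.inter_subset_right disjoint_compl_right))]
  rw [← Set.inter_union_distrib_left, Set.union_compl_self, Set.inter_univ]

end Weight

/-! ## Pinning an edge (conditioning = re-weighting) -/

section EdgeEvents

variable {E : Type*}

/-- The event that edge `e` is open. -/
def openEdge (e : E) : Set (Config E) := {ω | ω e = true}

/-- The event that edge `e` is closed. -/
def closedEdge (e : E) : Set (Config E) := {ω | ω e = false}

/-- Membership in `openEdge`. -/
@[simp] lemma mem_openEdge {e : E} {ω : Config E} : ω ∈ openEdge e ↔ ω e = true := Iff.rfl

/-- Membership in `closedEdge`. -/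
@[simp] lemma mem_closedEdge {e : E} {ω : Config E} : ω ∈ closedEdge e ↔ ω e = false := Iff.rfl

/-- `closedEdge` is the complement of `openEdge`. -/
lemma closedEdge_eq_compl (e : E) : (closedEdge e : Set (Config E)) = (openEdge e)ᶜ := by
  ext ω; simp

end EdgeEvents

section Pinning

variable {E : Type*} [Fintype E] [DecidableEq E] {R : Type*} [CommRing R]

/-- Weight with the factor of the edge `e` singled out. -/
lemma weight_eq_mul_edgeFactor (p : E → R) (ω : Config E) (e : E) :
    weight p ω = (∏ e' ∈ Finset.univ.erase e, edgeFactor (p e') (ω e')) * edgeFactor (p e) (ω e) :=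
  (Finset.prod_erase_mul _ _ (Finset.mem_univ e)).symm

/-- The product over the edges other than `e` only sees `p` and `ω` away from `e`. -/
lemma prod_erase_update_left (p : E → R) (ω : Config E) (e : E) (q : R) :
    (∏ e' ∈ Finset.univ.erase e, edgeFactor (Function.update p e q e') (ω e')) =
      ∏ e' ∈ Finset.univ.erase e, edgeFactor (p e') (ω e') := by
  refine Finset.prod_congr rfl fun e' he' => ?_
  rw [Function.update_of_ne (Finset.ne_of_mem_erase he')]

/-- The product over the edges other than `e` only sees `p` and `ω` away from `e`. -/
lemma prod_erase_update_right (p : E → R) (ω : Config E) (e : E) (b : Bool) :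
    (∏ e' ∈ Finset.univ.erase e, edgeFactor (p e') (Function.update ω e b e')) =
      ∏ e' ∈ Finset.univ.erase e, edgeFactor (p e') (ω e') := by
  refine Finset.prod_congr rfl fun e' he' => ?_
  rw [Function.update_of_ne (Finset.ne_of_mem_erase he')]

/-- **Pinning identity** (the exploration primitive): the weight of `ω` is the mixture of the
weights with edge `e` pinned open (`p e := 1`) and pinned closed (`p e := 0`). -/
lemma weight_eq_pin (p : E → R) (ω : Config E) (e : E) :
    weight p ω = p e * weight (Function.update p e 1) ω
      + (1 - p e) * weight (Function.update p e 0) ω := by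
  rw [weight_eq_mul_edgeFactor p ω e, weight_eq_mul_edgeFactor _ ω e,
    weight_eq_mul_edgeFactor _ ω e, prod_erase_update_left, prod_erase_update_left]
  cases ω e <;> simp [edgeFactor] <;> ring

/-- Pinned open, the weight vanishes on configurations where `e` is closed. -/
lemma weight_update_one_of_eq_false (p : E → R) {ω : Config E} {e : E} (h : ω e = false) :
    weight (Function.update p e 1) ω = 0 := by
  rw [weight_eq_mul_edgeFactor _ ω e]
  simp [h]

/-- Pinned closed, the weight vanishes on configurations where `e` is open. -/
lemma weight_update_zero_of_eq_true (p : E → R) {ω : Config E} {e : E} (h : ω e = true) :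
    weight (Function.update p e 0) ω = 0 := by
  rw [weight_eq_mul_edgeFactor _ ω e]
  simp [h]

/-- Pinning identity for expectations: `E_p f = p e · E_{p[e↦1]} f + (1 - p e) · E_{p[e↦0]} f`. -/
lemma expect_eq_pin (p : E → R) (f : Config E → R) (e : E) :
    expect p f = p e * expect (Function.update p e 1) f
      + (1 - p e) * expect (Function.update p e 0) f := by
  unfold expect
  rw [Finset.mul_sum, Finset.mul_sum, ← Finset.sum_add_distrib]
  refine Finset.sum_congr rfl fun ω _ => ?_
  rw [weight_eq_pin p ω e]
  ring

/-- Pinning identity for probabilities. -/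
lemma prob_eq_pin (p : E → R) (A : Set (Config E)) (e : E) :
    prob p A = p e * prob (Function.update p e 1) A
      + (1 - p e) * prob (Function.update p e 0) A := by
  simp only [prob_eq_expect_indicator]
  exact expect_eq_pin p _ e

/-- Under `p[e↦1]` the event `openEdge e` is sure (the weight vanishes off it). -/
lemma prob_update_one_inter_openEdge (p : E → R) (A : Set (Config E)) (e : E) :
    prob (Function.update p e 1) (A ∩ openEdge e) = prob (Function.update p e 1) A := by
  classical
  unfold prob
  refine Finset.sum_congr rfl fun ω _ => ?_
  by_cases h : ω e = true
  · simp [Set.indicator_apply, h]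
  · simp only [Bool.not_eq_true] at h
    simp [Set.indicator_apply, weight_update_one_of_eq_false p h]

/-- Under `p[e↦0]` the event `openEdge e` is null. -/
lemma prob_update_zero_inter_openEdge (p : E → R) (A : Set (Config E)) (e : E) :
    prob (Function.update p e 0) (A ∩ openEdge e) = 0 := by
  classical
  unfold prob
  refine Finset.sum_eq_zero fun ω _ => ?_
  by_cases h : ω e = true
  · simp [Set.indicator_apply, weight_update_zero_of_eq_true p h]
  · simp [h]

/-- Under `p[e↦0]` the event `closedEdge e` is sure. -/
lemma prob_update_zero_inter_closedEdge (p : E → R) (A : Set (Config E)) (e : E) :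
    prob (Function.update p e 0) (A ∩ closedEdge e) = prob (Function.update p e 0) A := by
  classical
  unfold prob
  refine Finset.sum_congr rfl fun ω _ => ?_
  by_cases h : ω e = true
  · simp [Set.indicator_apply, h, weight_update_zero_of_eq_true p h]
  · simp only [Bool.not_eq_true] at h
    simp [Set.indicator_apply, h]

/-- Under `p[e↦1]` the event `closedEdge e` is null. -/
lemma prob_update_one_inter_closedEdge (p : E → R) (A : Set (Config E)) (e : E) :
    prob (Function.update p e 1) (A ∩ closedEdge e) = 0 := by
  classical
  unfold prob
  refine Finset.sum_eq_zero fun ω _ => ?_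
  by_cases h : ω e = true
  · simp [h]
  · simp only [Bool.not_eq_true] at h
    simp [Set.indicator_apply, weight_update_one_of_eq_false p h]

/-- **Exploring an edge, open case**: `P_p(A ∩ {e open}) = p e · P_{p[e↦1]}(A)`. -/
lemma prob_inter_openEdge (p : E → R) (A : Set (Config E)) (e : E) :
    prob p (A ∩ openEdge e) = p e * prob (Function.update p e 1) A := by
  rw [prob_eq_pin p _ e, prob_update_one_inter_openEdge, prob_update_zero_inter_openEdge,
    mul_zero, add_zero]

/-- **Exploring an edge, closed case**: `P_p(A ∩ {e closed}) = (1 - p e) · P_{p[e↦0]}(A)`. -/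
lemma prob_inter_closedEdge (p : E → R) (A : Set (Config E)) (e : E) :
    prob p (A ∩ closedEdge e) = (1 - p e) * prob (Function.update p e 0) A := by
  rw [prob_eq_pin p _ e, prob_update_one_inter_closedEdge, prob_update_zero_inter_closedEdge,
    mul_zero, zero_add]

/-- The probability that an edge is open is its weight. -/
@[simp] lemma prob_openEdge (p : E → R) (e : E) : prob p (openEdge e) = p e := by
  have := prob_inter_openEdge p Set.univ e
  simpa using this

/-- The probability that an edge is closed is one minus its weight. -/
@[simp] lemma prob_closedEdge (p : E → R) (e : E) : prob p (closedEdge e) = 1 - p e := by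
  have := prob_inter_closedEdge p Set.univ e
  simpa using this

end Pinning

/-! ## Cylinder events -/

section Cylinder

variable {E : Type*} [Fintype E] [DecidableEq E] {R : Type*} [CommRing R]

/-- The cylinder event: the edges of `F` are in the states prescribed by `σ`. -/
def cylinder (F : Finset E) (σ : Config E) : Set (Config E) := {ω | ∀ e ∈ F, ω e = σ e}

omit [Fintype E] [DecidableEq E] in
/-- Membership in a cylinder. -/
@[simp] lemma mem_cylinder {F : Finset E} {σ ω : Config E} :
    ω ∈ cylinder F σ ↔ ∀ e ∈ F, ω e = σ e := Iff.rfl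

omit [Fintype E] in
/-- The cylinder over an inserted edge is the cylinder over `F` intersected with the edge event. -/
lemma cylinder_insert (F : Finset E) (σ : Config E) (e : E) :
    cylinder (insert e F) σ =
      cylinder F σ ∩ (if σ e = true then openEdge e else closedEdge e) := by
  ext ω
  simp only [mem_cylinder, Finset.mem_insert, Set.mem_inter_iff]
  constructor
  · intro h
    refine ⟨fun e' he' => h e' (Or.inr he'), ?_⟩
    have := h e (Or.inl rfl)
    cases hσ : σ e <;> simp [hσ] at this ⊢ <;> simpa [hσ] using this
  · rintro ⟨h1, h2⟩ e' he'
    rcases he' with rfl | he'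
    · cases hσ : σ e' <;> simp [hσ] at h2 ⊢ <;> simpa using h2
    · exact h1 e' he'

/-- **Cylinder probabilities**: `P(ω = σ on F) = ∏ e ∈ F, (p e if σ e else 1 - p e)`. -/
theorem prob_cylinder (F : Finset E) (σ : Config E) :
    ∀ p : E → R, prob p (cylinder F σ) = ∏ e ∈ F, edgeFactor (p e) (σ e) := by
  induction F using Finset.induction_on with
  | empty => intro p; simp [cylinder]
  | insert e F he ih =>
    intro p
    rw [cylinder_insert, Finset.prod_insert he]
    cases hσ : σ e
    · simp only [Bool.false_eq_true, if_false]
      rw [prob_inter_closedEdge, ih]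
      simp only [edgeFactor_false]
      congr 1
      exact Finset.prod_congr rfl fun e' he' =>
        by rw [Function.update_of_ne (fun h : e' = e => he (h ▸ he'))]
    · simp only [if_true]
      rw [prob_inter_openEdge, ih]
      simp only [edgeFactor_true]
      congr 1
      exact Finset.prod_congr rfl fun e' he' =>
        by rw [Function.update_of_ne (fun h : e' = e => he (h ▸ he'))]

/-- The event that all edges of `F` are open. -/
def allOpen (F : Finset E) : Set (Config E) := {ω | ∀ e ∈ F, ω e = true}

/-- The event that all edges of `F` are closed. -/
def allClosed (F : Finset E) : Set (Config E) := {ω | ∀ e ∈ F, ω e = false}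

omit [Fintype E] [DecidableEq E] in
/-- Membership in `allOpen`. -/
@[simp] lemma mem_allOpen {F : Finset E} {ω : Config E} : ω ∈ allOpen F ↔ ∀ e ∈ F, ω e = true :=
  Iff.rfl

omit [Fintype E] [DecidableEq E] in
/-- Membership in `allClosed`. -/
@[simp] lemma mem_allClosed {F : Finset E} {ω : Config E} :
    ω ∈ allClosed F ↔ ∀ e ∈ F, ω e = false := Iff.rfl

/-- `P(all edges of F open) = ∏ e ∈ F, p e`. -/
theorem prob_allOpen (p : E → R) (F : Finset E) : prob p (allOpen F) = ∏ e ∈ F, p e := by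
  have : allOpen F = cylinder F (fun _ => true) := rfl
  rw [this, prob_cylinder]
  rfl

/-- `P(all edges of F closed) = ∏ e ∈ F, (1 - p e)`. -/
theorem prob_allClosed (p : E → R) (F : Finset E) :
    prob p (allClosed F) = ∏ e ∈ F, (1 - p e) := by
  have : allClosed F = cylinder F (fun _ => false) := rfl
  rw [this, prob_cylinder]
  rfl

end Cylinder

end Summit.Ventures.PercRepro2
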